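import Literature.NumberTheory.EllipticCurves.HeegnerPointsKolyvaginPrimaryAssemblyProofs
import Literature.NumberTheory.EllipticCurves.LocalKummerIsotropyTransport
import Literature.NumberTheory.EllipticCurves.KummerImageIsotropyProofs
import Literature.NumberTheory.EllipticCurves.WeilPairingTateDual
import Literature.NumberTheory.EllipticCurves.SelmerLocalConditionGoodReductionProofs
import Literature.NumberTheory.GaloisRepresentations.DecompositionGroupOfCompletion
import Literature.NumberTheory.GaloisRepresentations.FrobeniusGeneration
import Literature.NumberTheory.GaloisRepresentations.IntegralGaloisActionProofs
import Literature.NumberTheory.EllipticCurves.HeegnerPointsKolyvaginLocalCriterion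
import Literature.NumberTheory.EllipticCurves.BSDSelmerPConverseSerreProofs
import Literature.NumberTheory.Automorphic.AdicCompletionLocalField
import Summits.BirchSwinnertonDyer.Rank1Residual.X11b.TameCupProductShape
import Summits.BirchSwinnertonDyer.Rank1Residual.GaloisImage.LocalH1TorsionBounded
import HarnessLib

/-!
# Kolyvagin reciprocity (R)_M at a Kolyvagin prime, from Poitou–Tate
# (cell `b2b-bsdres`, team x11b3 = N8/O2, (P3-B) FILE 2; lead R10-65 / R12-6 / R12-12)

HONEST FRAMING (cell `b2b-bsdres`, run/shared/lean/b2b/bsd-rank1-residual/, verbatim in every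
file): the goal of the cell is to DELETE the COMBINATION-SHAPED residual classes of the
Birch–Swinnerton-Dyer formula for ALL analytic-rank `≤ 1` elliptic curves over `ℚ` — "full BSD
formula for every rank `≤ 1` curve in class `C`" assembled STRICTLY from published theorems — so
that the rank-`≤ 1` remainder becomes exactly the CONSTRUCTION-SHAPED classes, which are TYPED
(missing-input `Prop`s), NOT attempted. This is not "finishing BSD". Team N8/O2 = `x11b3`: the
statement, the global half of the proof and the recipe of the local bridge are seat
`b2b-bsdres-x11b3-p3` GEN 10's (banked scratch, lead R10-65 / R12-6); the local bridge and the
filing are seat `b2b-bsdres-x11b3-p1` GEN 8's (lead R12-12, in place of the p3 successor).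
Plumbing / debt reduction on the PUBLISHED Kolyvagin finiteness theorem (Gross 1991, Thm. 1.3 (2)):
leaf (B) = Kolyvagin reciprocity (R)_M — the `hR` binder of
`KolyvaginDescent.Kolyvagin1990_sha_primary_finite_of_pointsM_of_reciprocityM`
(`HeegnerPointsKolyvaginPrimaryAssemblyProofs`) — becomes a TREE THEOREM MODULO the EXISTING
Poitou–Tate named fact `poitouTate_sum_localTatePairing_eq_zero K` (labelled binder `hPT`,
cite-only, NOT discharged, not dischargeable in the tree: no local class field theory invariant
maps). THEOREMS ONLY (no definition, no named fact, no `sorry`); labelled EXACTLY {`hPT`} +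
structural; nothing `p = 3`-specific. Wording of record (R12-12 (3), binding) = the docstring of
`Kolyvagin1990_sha_primary_finite_of_pointsM_of_poitouTate` below; nothing booked.

## The two theorems

* `kolyvaginReciprocityM_of_poitouTate` — **(R)_M from (PT)**: the `hR` binder of the consumer
  TOKEN FOR TOKEN, under `hPT`: for `E = W/ℚ` non-CM, `K` imaginary quadratic (`d_K ∉ {-3,-4}`,
  Heegner hypothesis for `N`), a non-torsion Heegner point, `p` odd with `ρ̄_{E,p}` onto, `M ≥ 1`,
  a Kolyvagin prime `ℓ` (place `λ`) with `Frob(ℓ) = Frob(∞)` on `K(E[p^M])`, the Weil pairing `e`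
  on `E[p^M]` (alternating, left-non-degenerate, packaged additively as `weilPairingHom`) satisfies
  `e([s, F], [c', σ]) = 0` for `s ∈ Sel_{p^M}(E/K)`, `c'` Selmer off `λ` and at `∞`, `𝔔 ∣ λ`,
  `F` an arithmetic Frobenius at `𝔔` fixing `E[p^M]`, `σ ∈ I_𝔔` — McCallum 1991, §2 Prop. 2.2
  (*"`Σ_v ⟨s_v, c_v⟩ = 0`"*) at `λ` through local Tate duality and Gross 1991, (7.6)
  (*"`ζ^{⟨c₁,c₂⟩} = {e₁, e₂}`"*, PDF p. 225), as used in Gross Prop. 8.1 (2) / 8.2, McCallum 5.3.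
  PROOF. (Global half, p3 GEN 10.) `e :=` the Weil pairing (`exists_weilPairing_holds`), `inv` the
  local invariant maps of `hPT` at level `p^M`. Off `λ` both `loc_v s`, `loc_v c'` satisfy the
  Kummer condition, so the local cup product vanishes (isotropy of the Kummer image,
  `kummerClass_cupProduct_kummerClass_eq_zero_holds` via
  `cupProduct_eq_zero_of_mem_kummerSelmerStructure_of_fact`); by (PT)
  (`sum_inv_weilCupProduct_localization_eq_zero`, `S = {λ}`) the term at `λ` vanishes too, and
  `inv_λ` is injective: `loc_λ s ∪ₑ loc_λ c' = 0` in `H²(K_λ, μ_{p^M})`.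
  (Local bridge, this file.) Let `𝔓₀ ∣ λ` be the prime of `\bar ℤ_K` cut out by the chosen
  embedding `K̄ → \bar K_λ` (`adicCompletionPrime`): `D_{𝔓₀} = res Γ_{K_λ}`, `I_{𝔓₀} = res I_{K_λ}`
  (`decompositionSubgroup_adicCompletionPrime_eq_range`, `inertia_adicCompletionPrime_eq_map_absInertia`,
  Neukirch II (9.6)). `Γ_K` is transitive on the primes above `λ`
  (`exists_smul_eq_of_mem_primesAbove_holds`): `g • 𝔔 = 𝔓₀`, so `F₀ = g F g⁻¹` is a Frobenius at
  `𝔓₀` (Mathlib `IsArithFrobAt.conj`) fixing `E[p^M]` (`Γ_{K(E[p^M])}` is normal) and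
  `σ₀ = g σ g⁻¹ ∈ I_{𝔓₀}`; `I_{𝔓₀}` fixes `E[p^M]` (good reduction at `λ ∤ p`, Silverman VII.4.1,
  `smul_geomTorsion_eq_of_mem_inertia`), hence so does `D_{𝔓₀} = ⟨F₀⟩ · I_{𝔓₀} · U`
  (`exists_eq_frobenius_pow_mul_of_mem_decompositionSubgroup`, `U = Γ_{K(E[p^M])}` open): `Γ_{K_λ}`
  acts trivially on `E[p^M]`. The restrictions `φ = f_s ∘ res`, `ψ = f_{c'} ∘ res` of the chosen
  cocycles represent `loc_λ s`, `loc_λ c'` (`res_torsionGaloisModule_oneCocycleClass`), and `φ`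
  vanishes on `I_{K_λ}` since `s` is Selmer at the good place `λ ∤ p^M` (Gross (7.1),
  `oneCocycleClass_mem_selmerLocalKer_iff`). FILE 1b (`TameCup.weilPairing_apply_eq_one_of_cupProduct_eq_zero`,
  Gross (7.6) qualitative; residue characteristic `≠ p`, frame `E[p^M] ≅ (ℤ/p^M)²` from
  `nonempty_addEquiv_geomTorsion`) gives `e([s, F₀], [c', σ₀]) = 1`; finally
  `[s, F] = g⁻¹ • [s, F₀]`, `[c', σ] = g⁻¹ • [c', σ₀]` (`h1Eval_conj`, Gross §9
  *"`[s, ρ^σ] = [s, ρ]^σ`"*) and `e` is `Γ_K`-equivariant, so `e([s, F], [c', σ]) = g⁻¹ • 1 = 1`.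
* `Kolyvagin1990_sha_primary_finite_of_pointsM_of_poitouTate` — the consumer's assembly with `hR`
  SUPPLIED by the previous theorem: `Kolyvagin1990_sha_primary_finite N W K` from `hPT` + the
  remaining labelled inputs EXACTLY {`hexc`, `hpoints`, `hK1`} (verbatim binders of the consumer).

Namespace `Summit.BirchSwinnertonDyer.Rank1Residual.X11b.KolyvaginReciprocity`; compactness of
absolute Galois groups (for the cup products inside the proof only) is a `have` in the proof;
axioms `propext`, `Classical.choice`, `Quot.sound`. References (locators only; the ONE cited input is the existing named fact `hPT`):
[cite: GrossLMS1991, §3 (3.1)–(3.2), §7 (7.1)–(7.6), Prop. 8.1 (2), Prop. 8.2, §9 (PDF pp. 216,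
223–226, 229)] [cite: McCallumLMS1991, §2 Prop. 2.2, §5 Lemma 5.3 (PDF pp. 277–286)]
[cite: MilneADT2006, Ch. I Cor. 2.3, Prop. 3.8, Thm. 4.10(b)] [cite: NeukirchANT1999, Ch. I §9
Prop. (9.1), (9.4); Ch. II §9 Prop. (9.6)] [cite: SilvermanAEC2009, Prop. VII.4.1(a), X.§4].
-/

noncomputable section

open scoped Classical Pointwise

universe u

namespace Summit.BirchSwinnertonDyer.Rank1Residual.X11b.KolyvaginReciprocity
open WeierstrassCurve NumberField IsDedekindDomain Field Function ValuativeRel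
open Literature.NumberTheory.EllipticCurves
open Literature.NumberTheory.GaloisRepresentations
open Literature.NumberTheory.GaloisRepresentations.IsNonarchimedeanLocalField
open Literature.NumberTheory.GaloisCohomology
open Literature.NumberTheory.GaloisRepresentations.DiscreteGaloisModule (mu MuCarrier)

variable (N : ℕ) [NeZero N] (W : WeierstrassCurve ℚ) (K : Type u) [Field K] [NumberField K]

/-- **Kolyvagin reciprocity (R)_M at a Kolyvagin prime, from Poitou–Tate** — the `hR` binder of
`KolyvaginDescent.Kolyvagin1990_sha_primary_finite_of_pointsM_of_reciprocityM` token for token,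
CONDITIONAL on the existing named fact `hPT : poitouTate_sum_localTatePairing_eq_zero K`
(Poitou–Tate, Milne *ADT* I Thm. 4.10(b) with Cor. 2.3; cite-only, NOT discharged). For `E = W/ℚ`
non-CM, `K` imaginary quadratic with `d_K ∉ {-3, -4}` and the Heegner hypothesis for `N`, a
non-torsion Heegner point `P`, `p` an odd prime with `ρ̄_{E,p}` onto, `M ≥ 1`, and a Kolyvagin
prime `ℓ` with `Frob(ℓ) = Frob(∞)` on `K(E[p^M])`: an alternating left-non-degenerate biadditive
pairing `e` on `E[p^M]` (the Weil pairing into `μ_{p^M}`) has `e([s, F], [c', σ]) = 0` for every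
`s ∈ Sel_{p^M}(E/K)`, every `c' ∈ H¹(K, E[p^M])` Selmer at the finite places `≠ λ` and at
infinity, every prime `𝔔 ∣ λ` of `\bar ℤ_K`, every arithmetic Frobenius `F` at `𝔔` fixing `E[p^M]`
and every `σ ∈ I_𝔔` (McCallum 1991, §2 Prop. 2.2 at `λ` through local Tate duality and Gross
1991, (7.6)). Proof: module docstring. [cite: McCallumLMS1991, §2 Prop. 2.2, §5 Lemma 5.3]
[cite: GrossLMS1991, §7 (7.1), (7.6), Prop. 8.1 (2), Prop. 8.2, §9]
[cite: MilneADT2006, Ch. I Thm. 4.10(b), Cor. 2.3, Prop. 3.8] [cite: NeukirchANT1999, Ch. II §9 Prop. (9.6)] -/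
theorem kolyvaginReciprocityM_of_poitouTate (hPT : poitouTate_sum_localTatePairing_eq_zero K) :
    ∀ [W.IsElliptic] (_hE : ¬ W.HasCM) (_hK : IsImaginaryQuadratic K)
      (_hD : NumberField.discr K ≠ -3 ∧ NumberField.discr K ≠ -4)
      (_hH : SatisfiesHeegnerHypothesis N K)
      {P : (W.baseChange K).toAffine.Point} (_hP : IsHeegnerPoint N W K P)
      (_hnt : ¬ IsOfFinAddOrder P) {p : ℕ} (_hp : p.Prime) (_hp2 : p ≠ 2)
      (_hρ : W.HasSurjectiveModNGaloisRep p) {M : ℕ} (_hM : 1 ≤ M)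
      {ℓ : ℕ} (hℓ : IsKolyvaginPrime N W K p ℓ), FrobEqFrobInfty W K (p ^ M) ℓ →
      ∃ (A : Type u) (_ : AddCommGroup A)
        (e : geomTorsion (W.baseChange K) ((p ^ M : ℕ) : ℤ) →+
          geomTorsion (W.baseChange K) ((p ^ M : ℕ) : ℤ) →+ A),
        (∀ x, e x x = 0) ∧ (∀ x, (∀ y, e x y = 0) → x = 0) ∧
        ∀ s ∈ selmerGroup (W.baseChange K) ((p ^ M : ℕ) : ℤ),
          ∀ c' : galH1Torsion (W.baseChange K) ((p ^ M : ℕ) : ℤ),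
          (∀ v : HeightOneSpectrum (𝓞 K), (ℓ : 𝓞 K) ∉ v.asIdeal →
            c' ∈ selmerLocalKer (W.baseChange K) (v.adicCompletion K) ((p ^ M : ℕ) : ℤ)) →
          (∀ w : InfinitePlace K,
            c' ∈ selmerLocalKer (W.baseChange K) w.Completion ((p ^ M : ℕ) : ℤ)) →
          ∀ 𝔔 ∈ hℓ.place.primesAbove, ∀ F : Field.absoluteGaloisGroup K,
            IsArithFrobAt (𝓞 K) F 𝔔 →
            F ∈ torsionFixing (W.baseChange K) ((p ^ M : ℕ) : ℤ) →
            ∀ σ ∈ 𝔔.inertia (Field.absoluteGaloisGroup K),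
            e (h1Eval (W.baseChange K) ((p ^ M : ℕ) : ℤ) s F)
              (h1Eval (W.baseChange K) ((p ^ M : ℕ) : ℤ) c' σ) = 0 := by
  intro _ hE hK hD hH P hP hnt p hp hp2 hρ M hM ℓ hℓ hℓM
  -- compactness of absolute Galois groups (cup products), as a local hypothesis
  have _hΓc : ∀ (L : Type u) [Field L], CompactSpace (absoluteGaloisGroup L) :=
    fun L _ => absoluteGaloisGroup_compactSpace L
  haveI : NeZero (p ^ M) := ⟨pow_ne_zero _ hp.ne_zero⟩
  have hq2 : 2 ≤ p ^ M := le_trans hp.two_le (Nat.le_self_pow (by omega) p)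
  have hqK : ((p ^ M : ℕ) : K) ≠ 0 := Nat.cast_ne_zero.mpr (NeZero.ne (p ^ M))
  -- the Weil pairing on `E[p^M]` over `K`
  obtain ⟨e, hμ, hadd₁, hadd₂, halt, hnondeg, hgal⟩ :=
    (W.baseChange K).exists_weilPairing_holds (p ^ M) hq2 hqK
  refine ⟨MuCarrier K (p ^ M), inferInstance,
    weilPairingHom (W.baseChange K) (p ^ M) e hμ hadd₁ hadd₂,
    weilPairingHom_self (W.baseChange K) (p ^ M) e hμ hadd₁ hadd₂ halt,
    TameCup.weilPairingHom_left_nondeg (W.baseChange K) (p ^ M) e hμ hadd₁ hadd₂ halt hnondeg, ?_⟩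
  intro s hs c' hc'fin hc'inf 𝔔 h𝔔 F hF hFfix σ hσ
  -- ### the family of local invariant maps of the Poitou–Tate fact at level `p^M`
  obtain ⟨inv, hperf, hsum⟩ := hPT (p ^ M)
  set lam := hℓ.place
  -- ### local terms vanish off `λ`: both classes satisfy the Kummer condition there (isotropy)
  have hsS : s ∈ ((W.baseChange K).kummerSelmerStructure ((p ^ M : ℕ) : ℤ)).selmerGroup := by
    rw [← selmerGroup_eq_selmerGroup_kummerSelmerStructure]; exact hs
  have hloc_s : ∀ v : Place K, galoisCohomology.localization ((W.baseChange K).torsionGaloisModule ((p ^ M : ℕ) : ℤ)) v 1 s ∈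
      (W.baseChange K).kummerSelmerStructure ((p ^ M : ℕ) : ℤ) v :=
    ((((W.baseChange K).kummerSelmerStructure ((p ^ M : ℕ) : ℤ)).mem_selmerGroup_iff s).mp hsS)
  have hloc_c' : ∀ v : Place K, v ≠ Sum.inr lam →
      galoisCohomology.localization ((W.baseChange K).torsionGaloisModule ((p ^ M : ℕ) : ℤ)) v 1 c' ∈
        (W.baseChange K).kummerSelmerStructure ((p ^ M : ℕ) : ℤ) v := by
    intro v hv
    have hmem : c' ∈ selmerLocalKer (W.baseChange K) (Place.Completion v) ((p ^ M : ℕ) : ℤ) := by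
      rcases v with w | v
      · exact hc'inf w
      · refine hc'fin v (fun h => hv ?_)
        rw [hℓ.mem_iff.mp h]
    rw [← (W.baseChange K).comap_localization_kummerSelmerStructure ((p ^ M : ℕ) : ℤ) v] at hmem
    exact hmem
  have hS : ∀ v ∉ ({Sum.inr lam} : Finset (Place K)),
      inv v ((weilContPairingLocal (W.baseChange K) (p ^ M) e hμ hadd₁ hadd₂ hgal v).cupProduct
        (galoisCohomology.localization ((W.baseChange K).torsionGaloisModule ((p ^ M : ℕ) : ℤ)) v 1 s)
        (galoisCohomology.localization ((W.baseChange K).torsionGaloisModule ((p ^ M : ℕ) : ℤ)) v 1 c')) = 0 := by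
    intro v hv
    rw [Finset.mem_singleton] at hv
    have h0 := (W.baseChange K).cupProduct_eq_zero_of_mem_kummerSelmerStructure_of_fact (p ^ M) e
      (by exact_mod_cast NeZero.ne (p ^ M)) v (kummerClass_cupProduct_kummerClass_eq_zero_holds (Place.Completion v))
      hμ hadd₁ hadd₂ halt hgal (hloc_s v) (hloc_c' v hv)
    exact (congrArg (inv v) h0).trans (map_zero _)
  -- ### Poitou–Tate: the local term at `λ` vanishes too, hence the local cup product is zero
  have hPTsum := sum_inv_weilCupProduct_localization_eq_zero (W.baseChange K) (p ^ M) e hμ hadd₁ hadd₂ hgal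
    inv hsum s c' {Sum.inr lam} hS
  rw [Finset.sum_singleton] at hPTsum
  have hcup : ((weilContPairing (W.baseChange K) (p ^ M) e hμ hadd₁ hadd₂ hgal).restrict
      (absGaloisRestrict K (lam.adicCompletion K))).cupProduct
        (galoisCohomology.localization ((W.baseChange K).torsionGaloisModule ((p ^ M : ℕ) : ℤ)) (Sum.inr lam) 1 s)
        (galoisCohomology.localization ((W.baseChange K).torsionGaloisModule ((p ^ M : ℕ) : ℤ)) (Sum.inr lam) 1 c') = 0 :=
    (hperf lam).1.injective (hPTsum.trans (map_zero _).symm)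
  -- ### the local step (FILE 1b) at `K_λ`: bridge `Γ_K`-decomposition data ↔ `Γ_{K_λ}`
  haveI : Fact p.Prime := ⟨hp⟩
  haveI : CharZero (lam.adicCompletion K) :=
    charZero_of_injective_algebraMap (algebraMap K (lam.adicCompletion K)).injective
  have hp0 : ((p ^ M : ℕ) : ℤ) ≠ 0 := by exact_mod_cast NeZero.ne (p ^ M)
  -- good reduction at `λ`, `p ∉ λ`, `p ^ M ∉ λ`
  have hbad : lam ∉ (W.baseChange K).badPlaces (𝓞 K) := hℓ.not_mem_badPlaces hP
  have hgood : (W.baseChange K).HasGoodReductionAt lam := by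
    have h := hbad
    rwa [WeierstrassCurve.mem_badPlaces_iff, not_not] at h
  have hpv : ((p : ℕ) : 𝓞 K) ∉ lam.asIdeal :=
    not_natCast_mem_of_prime_ne hℓ.prime hp hℓ.2.2.2.1 lam hℓ.mem_place
  have hqv : ((((p ^ M : ℕ) : ℤ)) : 𝓞 K) ∉ lam.asIdeal := by
    rw [Int.cast_natCast, Nat.cast_pow]
    exact fun h => hpv (lam.isPrime.mem_of_pow_mem M h)
  -- the prime `𝔓₀ ∣ λ` cut out by `K̄ → \bar K_λ`; `g • 𝔔 = 𝔓₀` (transitivity of `Γ_K`)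
  have h𝔓₀ : adicCompletionPrime K lam ∈ lam.primesAbove := adicCompletionPrime_mem_primesAbove K lam
  obtain ⟨g, hg⟩ := HeightOneSpectrum.exists_smul_eq_of_mem_primesAbove_holds h𝔔 h𝔓₀
  have hDeq := decompositionSubgroup_adicCompletionPrime_eq_range K lam
  have hIeq := inertia_adicCompletionPrime_eq_map_absInertia K lam
  -- `F₀ = g F g⁻¹` is a Frobenius at `𝔓₀` fixing `E[p^M]`; `σ₀ = g σ g⁻¹ ∈ I_{𝔓₀}`
  have hF₀ : IsArithFrobAt (𝓞 K) (g * F * g⁻¹) (adicCompletionPrime K lam) := by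
    have h := hF.conj g
    rwa [hg] at h
  have hF₀fix : g * F * g⁻¹ ∈ torsionFixing (W.baseChange K) ((p ^ M : ℕ) : ℤ) :=
    (torsionFixing_normal (W.baseChange K) _).conj_mem F hFfix g
  have hσ₀ : g * σ * g⁻¹ ∈ (adicCompletionPrime K lam).inertia (absoluteGaloisGroup K) := by
    rw [← hg]
    intro x
    have hx := Ideal.smul_mem_pointwise_smul g _ 𝔔 (hσ (g⁻¹ • x))
    rwa [smul_sub, smul_inv_smul, ← mul_smul, ← mul_smul] at hx
  -- inertia at `𝔓₀` fixes `E[p^M]` (good reduction, `λ ∤ p`)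
  have hI₀ : (adicCompletionPrime K lam).inertia (absoluteGaloisGroup K) ≤
      torsionFixing (W.baseChange K) ((p ^ M : ℕ) : ℤ) := fun τ hτ =>
    (mem_torsionFixing_iff _ _).mpr fun Q =>
      (W.baseChange K).smul_geomTorsion_eq_of_mem_inertia hgood hqv h𝔓₀ hτ Q
  have hσ₀fix : g * σ * g⁻¹ ∈ torsionFixing (W.baseChange K) ((p ^ M : ℕ) : ℤ) := hI₀ hσ₀
  -- `F₀ = res gF`, `σ₀ = res t` with `t ∈ I_{K_λ}` (`D_{𝔓₀} = res Γ_{K_λ}`, `I_{𝔓₀} = res I_{K_λ}`)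
  obtain ⟨gF, hgF⟩ : ∃ gF : absoluteGaloisGroup (lam.adicCompletion K),
      absGaloisRestrict K (lam.adicCompletion K) gF = g * F * g⁻¹ := by
    have hmem : g * F * g⁻¹ ∈
        (adicCompletionPrime K lam).decompositionSubgroup (absoluteGaloisGroup K) :=
      hF₀.mem_stabilizer
    rw [hDeq] at hmem
    obtain ⟨gF, hgF⟩ := hmem
    exact ⟨gF, hgF⟩
  obtain ⟨t, ht, hgt⟩ : ∃ t ∈ absInertia (lam.adicCompletion K),
      absGaloisRestrict K (lam.adicCompletion K) t = g * σ * g⁻¹ := by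
    have hmem := hσ₀
    rw [hIeq] at hmem
    obtain ⟨t, ht, hgt⟩ := hmem
    exact ⟨t, ht, hgt⟩
  -- `Γ_{K_λ}` acts trivially on `E[p^M]`: `D_{𝔓₀} = ⟨F₀⟩ · I_{𝔓₀} · Γ_{K(E[p^M])}`
  have htriv : ∀ (g' : absoluteGaloisGroup (lam.adicCompletion K))
      (Q : geomTorsion (W.baseChange K) ((p ^ M : ℕ) : ℤ)),
      absGaloisRestrict K (lam.adicCompletion K) g' • Q = Q := by
    intro g' Q
    have hd : absGaloisRestrict K (lam.adicCompletion K) g' ∈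
        (adicCompletionPrime K lam).decompositionSubgroup (absoluteGaloisGroup K) := by
      rw [hDeq]; exact ⟨g', rfl⟩
    obtain ⟨k, i, u, hi, hu, hdeq⟩ := exists_eq_frobenius_pow_mul_of_mem_decompositionSubgroup
      h𝔓₀ hF₀ (isOpen_torsionFixing (W.baseChange K) hp0) hd
    have hmem : absGaloisRestrict K (lam.adicCompletion K) g' ∈
        torsionFixing (W.baseChange K) ((p ^ M : ℕ) : ℤ) := by
      rw [hdeq]
      exact Subgroup.mul_mem _ (Subgroup.mul_mem _ (Subgroup.pow_mem _ hF₀fix k) (hI₀ hi)) hu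
    exact smul_eq_of_mem_torsionFixing _ _ hmem Q
  -- the residue characteristic of `K_λ` is prime to `p ^ M` (`λ ∤ p`)
  have hn : ¬ ringChar 𝓀[lam.adicCompletion K] ∣ p ^ M := fun h =>
    GaloisImage.ringChar_residueField_adicCompletion_ne_of_not_mem lam p hpv
      ((Nat.prime_dvd_prime_iff_eq (ringChar_residueField_prime (F := lam.adicCompletion K)) hp).mp
        ((ringChar_residueField_prime (F := lam.adicCompletion K)).dvd_of_dvd_pow h)).symm
  -- a frame `E[p^M] ≃ (ℤ/p^M)²`
  obtain ⟨ε₀⟩ := nonempty_addEquiv_geomTorsion (W.baseChange K) p M hM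
    (Nat.cast_ne_zero.mpr hp.ne_zero)
  let ε : geomTorsion (W.baseChange K) ((p ^ M : ℕ) : ℤ) ≃+ ZMod (p ^ M) × ZMod (p ^ M) :=
    ε₀.trans (LinearEquiv.finTwoArrow ℤ (ZMod (p ^ M))).toAddEquiv
  -- the injective local invariant map at `λ`
  have hinv : Function.Injective (inv (Sum.inr lam)) := (hperf lam).1.injective
  -- the local cocycles: restrictions to `Γ_{K_λ}` of the chosen cocycles of `s` and `c'`
  let φ : contOneCocycles (DiscreteGaloisModule.toTopRep (GaloisRep.restrictField
      (lam.adicCompletion K) ((W.baseChange K).torsionGaloisModule ((p ^ M : ℕ) : ℤ)))) :=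
    contOneCocycles.pullback (absGaloisRestrict K (lam.adicCompletion K))
      (X := discreteTopRep (absoluteGaloisGroup K) (geomTorsion (W.baseChange K) ((p ^ M : ℕ) : ℤ)))
      (Y := DiscreteGaloisModule.toTopRep (GaloisRep.restrictField (lam.adicCompletion K)
        ((W.baseChange K).torsionGaloisModule ((p ^ M : ℕ) : ℤ))))
      (TopRep.ofHom ⟨ContinuousLinearMap.id ℤ _, fun _ => rfl⟩)
      (reprCocycle (W.baseChange K) ((p ^ M : ℕ) : ℤ) s)
  let ψ : contOneCocycles (DiscreteGaloisModule.toTopRep (GaloisRep.restrictField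
      (lam.adicCompletion K) ((W.baseChange K).torsionGaloisModule ((p ^ M : ℕ) : ℤ)))) :=
    contOneCocycles.pullback (absGaloisRestrict K (lam.adicCompletion K))
      (X := discreteTopRep (absoluteGaloisGroup K) (geomTorsion (W.baseChange K) ((p ^ M : ℕ) : ℤ)))
      (Y := DiscreteGaloisModule.toTopRep (GaloisRep.restrictField (lam.adicCompletion K)
        ((W.baseChange K).torsionGaloisModule ((p ^ M : ℕ) : ℤ))))
      (TopRep.ofHom ⟨ContinuousLinearMap.id ℤ _, fun _ => rfl⟩)
      (reprCocycle (W.baseChange K) ((p ^ M : ℕ) : ℤ) c')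
  have hφcl : galoisCohomology.localization ((W.baseChange K).torsionGaloisModule ((p ^ M : ℕ) : ℤ))
      (Sum.inr lam) 1 s = oneCocycleClass _ φ := by
    have h := (W.baseChange K).res_torsionGaloisModule_oneCocycleClass ((p ^ M : ℕ) : ℤ)
      (lam.adicCompletion K) (reprCocycle (W.baseChange K) ((p ^ M : ℕ) : ℤ) s)
    rw [oneCocycleClass_reprCocycle] at h
    exact h
  have hψcl : galoisCohomology.localization ((W.baseChange K).torsionGaloisModule ((p ^ M : ℕ) : ℤ))
      (Sum.inr lam) 1 c' = oneCocycleClass _ ψ := by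
    have h := (W.baseChange K).res_torsionGaloisModule_oneCocycleClass ((p ^ M : ℕ) : ℤ)
      (lam.adicCompletion K) (reprCocycle (W.baseChange K) ((p ^ M : ℕ) : ℤ) c')
    rw [oneCocycleClass_reprCocycle] at h
    exact h
  rw [hφcl, hψcl] at hcup
  -- `φ` vanishes on `I_{K_λ}`: `s` is Selmer at the good place `λ ∤ p^M` (Gross (7.1))
  have hsel : s ∈ selmerLocalKer (W.baseChange K) (lam.adicCompletion K) ((p ^ M : ℕ) : ℤ) :=
    ((mem_selmerGroup_iff (W.baseChange K) _ s).mp hs).1 lam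
  have hsI : ∀ τ ∈ (adicCompletionPrime K lam).inertia (absoluteGaloisGroup K),
      (reprCocycle (W.baseChange K) ((p ^ M : ℕ) : ℤ) s).1 τ = 0 := by
    have h := hsel
    rw [← oneCocycleClass_reprCocycle (W.baseChange K) ((p ^ M : ℕ) : ℤ) s] at h
    exact ((W.baseChange K).oneCocycleClass_mem_selmerLocalKer_iff hgood hqv h𝔓₀ _).mp h
  have hφ : ∀ t' ∈ absInertia (lam.adicCompletion K), φ.1 t' = 0 := by
    intro t' ht'
    have hmem : absGaloisRestrict K (lam.adicCompletion K) t' ∈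
        (adicCompletionPrime K lam).inertia (absoluteGaloisGroup K) := by
      rw [hIeq]; exact ⟨t', ht', rfl⟩
    have h0 : (reprCocycle (W.baseChange K) ((p ^ M : ℕ) : ℤ) s).1
        (absGaloisRestrict K (lam.adicCompletion K) t') = 0 := hsI _ hmem
    rw [contOneCocycles.pullback_apply, h0, map_zero]
  -- FILE 1b at `K_λ`: `e([s, F₀], [c', σ₀]) = 1`
  have hloc := TameCup.weilPairing_apply_eq_one_of_cupProduct_eq_zero (W.baseChange K) (p ^ M)
    e hμ hadd₁ hadd₂ (lam.adicCompletion K) halt hnondeg hgal ε hn htriv (inv (Sum.inr lam)) hinv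
    φ ψ hφ hcup gF t ht
  rw [contOneCocycles.pullback_apply, contOneCocycles.pullback_apply, hgF, hgt] at hloc
  change e (h1Eval (W.baseChange K) ((p ^ M : ℕ) : ℤ) s (g * F * g⁻¹))
    (h1Eval (W.baseChange K) ((p ^ M : ℕ) : ℤ) c' (g * σ * g⁻¹)) = 1 at hloc
  -- transport along `g`: `[s, F] = g⁻¹ • [s, F₀]`, `[c', σ] = g⁻¹ • [c', σ₀]`, `e` equivariant
  have hconjF : g⁻¹ * (g * F * g⁻¹) * g⁻¹⁻¹ = F := by group
  have hconjσ : g⁻¹ * (g * σ * g⁻¹) * g⁻¹⁻¹ = σ := by group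
  have h1 : h1Eval (W.baseChange K) ((p ^ M : ℕ) : ℤ) s F =
      g⁻¹ • h1Eval (W.baseChange K) ((p ^ M : ℕ) : ℤ) s (g * F * g⁻¹) := by
    rw [← h1Eval_conj (W.baseChange K) _ s g⁻¹ hF₀fix, hconjF]
  have h2 : h1Eval (W.baseChange K) ((p ^ M : ℕ) : ℤ) c' σ =
      g⁻¹ • h1Eval (W.baseChange K) ((p ^ M : ℕ) : ℤ) c' (g * σ * g⁻¹) := by
    rw [← h1Eval_conj (W.baseChange K) _ c' g⁻¹ hσ₀fix, hconjσ]
  rw [TameCup.weilPairingHom_eq_zero_iff, h1, h2, ← hgal, hloc, smul_one]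

/-- **`Kolyvagin1990_sha_primary_finite` from Heegner-type points and Poitou–Tate** — the
consumer's assembly `KolyvaginDescent.Kolyvagin1990_sha_primary_finite_of_pointsM_of_reciprocityM`
with its binder `hR` (Kolyvagin reciprocity (R)_M) SUPPLIED by `kolyvaginReciprocityM_of_poitouTate`.
Remaining labelled inputs EXACTLY {`hexc`, `hpoints`, `hK1`} (verbatim binders of the consumer:
the CM / `d_K ∈ {-3,-4}` leaf, leaf (A′) = Heegner-type points `P_m` with their local behaviour,
[K1, Thm. A] for `p = 2` or `ρ̄` not onto) + `hPT` (Poitou–Tate, existing named fact, cite-only) +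
structural; the Literature finiteness theorem keeps `hR` as printed. Wording (binding, lead
R12-12 (3)): "(R)_M supplied by theorem modulo the Poitou–Tate named fact `hPT`; finiteness of
`Ш(E/K)[p^∞]` for the given Kolyvagin data remains CONDITIONAL on `hpoints` (= leaf (A′), whose
clauses are homed at concrete currency modulo {(γ), (A′-53), [GZ86 III (3.1)]} ∪ {hrec}) + `hexc`
+ `hK1` + `hPT`; nothing discharged on the residual map; node / counts unchanged; nothing
booked". [cite: GrossLMS1991, §1 Thm. 1.3 (2), §§3–8] [cite: McCallumLMS1991, §1 Theorem
(Kolyvagin), §2 Prop. 2.2, §§4–5] [cite: MilneADT2006, Ch. I Thm. 4.10(b)] -/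
theorem Kolyvagin1990_sha_primary_finite_of_pointsM_of_poitouTate
    (hPT : poitouTate_sum_localTatePairing_eq_zero K)
    (hexc : Kolyvagin1990_thmA_of_hasCM_or_discr N W K)
    (hpoints : ∀ [W.IsElliptic] (_hE : ¬ W.HasCM) (_hK : IsImaginaryQuadratic K)
      (_hD : NumberField.discr K ≠ -3 ∧ NumberField.discr K ≠ -4)
      (_hH : SatisfiesHeegnerHypothesis N K)
      {P : (W.baseChange K).toAffine.Point} (_hP : IsHeegnerPoint N W K P)
      (_hnt : ¬ IsOfFinAddOrder P) {p : ℕ} (_hp : p.Prime) (_hp2 : p ≠ 2)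
      (_hρ : W.HasSurjectiveModNGaloisRep p) {M : ℕ} (_hM : 1 ≤ M)
      (hdiv : ∀ Q : geomPoints (W.baseChange K), ∃ R, ((p ^ M : ℕ) : ℤ) • R = Q)
      (c : K ≃ₐ[ℚ] K) (_hc : c ≠ 1),
      ∃ (ε : ℤ) (τ : AlgebraicClosure K ≃+* AlgebraicClosure K) (hτ : IsLiftOfAut c τ)
        (A : ℕ → AddSubgroup (geomPoints (W.baseChange K)))
        (hA : ∀ m, KolyvaginCocycle.IsAdmissible (Field.absoluteGaloisGroup K) (A m)
          ((p ^ M : ℕ) : ℤ))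
        (Pt : ℕ → geomPoints (W.baseChange K))
        (hPt : ∀ m, Pt m ∈
          KolyvaginCocycle.invPoints (Field.absoluteGaloisGroup K) (A m) ((p ^ M : ℕ) : ℤ)),
        (ε = 1 ∨ ε = -1) ∧
        IsOfFinAddOrder (Affine.Point.map (W' := W) (c : K →ₐ[ℚ] K) P - ε • P) ∧
        (∀ m, ∀ a ∈ A m, hτ.pointsMap W a ∈ A m) ∧
        Pt 1 = toGeomPoints (W.baseChange K) P ∧
        (∀ m : ℕ, Squarefree m →
          (∀ q ∈ m.primeFactors, IsKolyvaginPrime N W K p q ∧ FrobEqFrobInfty W K (p ^ M) q) →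
          (∃ B ∈ A m, hτ.pointsMap W (Pt m) =
            (ε * (-1) ^ m.primeFactors.card) • Pt m + ((p ^ M : ℕ) : ℤ) • B) ∧
          (∀ v : HeightOneSpectrum (𝓞 K), (m : 𝓞 K) ∉ v.asIdeal →
            kolyvaginClass (W.baseChange K) _ hdiv (hA m) (Pt m) (hPt m) ∈
              selmerLocalKer (W.baseChange K) (v.adicCompletion K) ((p ^ M : ℕ) : ℤ)) ∧
          (∀ ℓ : ℕ, ℓ.Prime → ℓ ∣ m → ∀ v : HeightOneSpectrum (𝓞 K), (ℓ : 𝓞 K) ∈ v.asIdeal →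
            ∀ a : ℕ, (((p : ℤ) ^ a) •
                kolyvaginClass (W.baseChange K) _ hdiv (hA m) (Pt m) (hPt m) ∈
                selmerLocalKer (W.baseChange K) (v.adicCompletion K) ((p ^ M : ℕ) : ℤ) ↔
              ((p : ℤ) ^ a) • kolyvaginClass (W.baseChange K) _ hdiv (hA (m / ℓ)) (Pt (m / ℓ))
                  (hPt (m / ℓ)) ∈
                (W.baseChange K).torsionLocalKer (v.adicCompletion K) ((p ^ M : ℕ) : ℤ)))))
    (hK1 : ∀ [W.IsElliptic] (_hE : ¬ W.HasCM)
      (_hD : NumberField.discr K ≠ -3 ∧ NumberField.discr K ≠ -4) (_hK : IsImaginaryQuadratic K)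
      (_hH : SatisfiesHeegnerHypothesis N K) {P : (W.baseChange K).toAffine.Point}
      (_hP : IsHeegnerPoint N W K P) (_hnt : ¬ IsOfFinAddOrder P) (p : ℕ) (_hp : p.Prime),
      (p = 2 ∨ ¬ W.HasSurjectiveModNGaloisRep p) →
      Set.Finite {c : (W.baseChange K).sha | ∃ j : ℕ, p ^ j • c = 0}) :
    Kolyvagin1990_sha_primary_finite N W K :=
  KolyvaginDescent.Kolyvagin1990_sha_primary_finite_of_pointsM_of_reciprocityM N W K hexc hpoints
    (kolyvaginReciprocityM_of_poitouTate N W K hPT) hK1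

end Summit.BirchSwinnertonDyer.Rank1Residual.X11b.KolyvaginReciprocity

end
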